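import Summits.NavierStokesRegularity.NavierStokesRegularity.Theorems.ApexLocalisation.Negative.LogicAndLoadBearing
import Literature.Analysis.FluidPDE.SuitableWeakRescaling
import Literature.Analysis.FluidPDE.LocalTypeIScaling

/-!
# `ApexLocalisation` (crux stmt-NavierStokesRegularity-11719): final-slice structure, translation
# covariance of the rate class, the apex ⇔ rate + spatial-bound dictionary, refuted strengthenings
# — negative-side support (cdisprove seat, gen 2)

Second file of importable lemmas of the standing disprover of `RellichScar.ApexLocalisation`
(companion of `Negative/LogicAndLoadBearing.lean`), all sorry-free:

* §3 FINAL SLICE: under the Type-I RATE no backward singular point has negative time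
  (`not_isBackwardSingularPoint_of_rate_of_neg`); the final-slice singular set
  `finalSliceSingularSet u = {x | (0,x) singular}` is closed; under the apex bound it is `{0}`; for
  the parasitic flow it is all of `ℝ³`. So the crux is an ISOLATION statement.
* §3b TRANSLATION COVARIANCE of the rate class (CKN covariance `IsSuitableWeakSolutionOn.stRescale`
  with `α = γ = 1`, `typeIBound_nsZoom`, `eLpNorm_top_nsZoom`): the antecedent of the crux ⇔ "a
  Type-I-rate slab solution with `𝐈 < ⊤` is singular SOMEWHERE at a time `≤ 0`"
  (`rateProfileExists_iff_singular_somewhere`).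
* §4 DICTIONARY: apex bound ⇔ rate ∧ global spatial bound `‖x‖‖u‖ ≤ K` (constants `C ↦ C + K`);
  the spatial-bound form of the crux.
* §5 REFUTED STRENGTHENINGS: "some translate/zoom of the SAME profile is apex" is false without
  `𝐈 < ⊤` (parasitic orbit is a point); "rate ⇒ apex" is false pointwise.

## References

* L. Caffarelli, R. Kohn, L. Nirenberg, CPAM 35 (1982), §2 (covariance). [CaffarelliKohnNirenberg1982]
* G. Koch, N. Nadirashvili, G. Seregin, V. Šverák, Acta Math. 203 (2009), (1.4), (1.6). [KNSS2009]
* D. Albritton, T. Barker, J. Math. Fluid Mech. 21 (2019), §1. [AlbrittonBarker2019]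
-/

noncomputable section

open MeasureTheory TopologicalSpace Set Function Filter Topology Metric
open scoped InnerProductSpace RealInnerProductSpace ENNReal NNReal
open Literature.Analysis.FluidPDE
open Summit.NavierStokesRegularity.NavierStokesRegularity.Theses

set_option linter.dupNamespace false

namespace Summit.NavierStokesRegularity.NavierStokesRegularity.Theorems.ApexLocalisation.Negative

/-- Physical space. -/
local notation "ℝ³" => EuclideanSpace ℝ (Fin 3)

/-- The open backward slab `(-∞,0) × ℝ³` (time first), as in the route file. -/
local notation "𝕊" => Literature.Analysis.FluidPDE.slab (EuclideanSpace ℝ (Fin 3)) (Set.Iio (0 : ℝ)) isOpen_Iio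

variable {C : ℝ} {u : ℝ → ℝ³ → ℝ³} {p : ℝ → ℝ³ → ℝ} {G : ℝ → ℝ³ → ℝ³ →L[ℝ] ℝ³}

/-! ## §3 Final-slice structure of the singular set -/

/-- **Under the rate, no backward singular point has negative time**: on `Q((t₀,x₀),1)`,
`t₀ < 0`, the rate gives `‖u‖ ≤ |C|/√(−t₀)`. So all singular points (with `t ≤ 0`) of a rate
profile lie on the final slice `{t = 0}` (times `t > 0` are outside the slab: junk region). -/
theorem not_isBackwardSingularPoint_of_rate_of_neg {C : ℝ} {u : ℝ → ℝ³ → ℝ³}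
    (h : HasTypeITimeDecay C u) {t₀ : ℝ} (ht₀ : t₀ < 0) (x₀ : ℝ³) :
    ¬ IsBackwardSingularPoint u (t₀, x₀) := by
  intro hs
  have hs0 : 0 < Real.sqrt (-t₀) := Real.sqrt_pos.2 (by linarith)
  have hbound : ∀ z ∈ parabolicCylinder 1 (t₀, x₀), ‖uncurry u z‖ ≤ |C| / Real.sqrt (-t₀) := by
    rintro ⟨t, x⟩ hz
    rw [mem_parabolicCylinder] at hz
    obtain ⟨⟨-, ht⟩, -⟩ := hz
    have ht' : t < t₀ := ht
    have ht0 : t < 0 := ht'.trans ht₀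
    calc ‖u t x‖ ≤ C / Real.sqrt (-t) := h t ht0 x
      _ ≤ |C| / Real.sqrt (-t) := div_le_div_of_nonneg_right (le_abs_self C) (Real.sqrt_nonneg _)
      _ ≤ |C| / Real.sqrt (-t₀) :=
          div_le_div_of_nonneg_left (abs_nonneg C) hs0 (Real.sqrt_le_sqrt (by linarith))
  have hlt : eLpNorm (uncurry u) ∞ (volume.restrict (parabolicCylinder 1 (t₀, x₀))) < ⊤ := by
    rw [eLpNorm_exponent_top]
    exact eLpNormEssSup_lt_top_of_ae_bound
      (ae_restrict_of_forall_mem (isOpen_parabolicCylinder 1 _).measurableSet hbound)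
  exact hlt.ne (hs 1 one_pos)

/-- The final-slice singular set `Σ(u) = {x | (0, x) is a backward singular point}`. -/
def finalSliceSingularSet (u : ℝ → ℝ³ → ℝ³) : Set ℝ³ :=
  {x | IsBackwardSingularPoint u ((0 : ℝ), x)}

/-- `Σ(u)` is closed (its complement is open: `Q((0,y), r/2) ⊆ Q((0,x), r)` for `y ∈ B(x, r/2)`). -/
theorem isClosed_finalSliceSingularSet (u : ℝ → ℝ³ → ℝ³) : IsClosed (finalSliceSingularSet u) := by
  rw [← isOpen_compl_iff, Metric.isOpen_iff]
  intro x hx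
  simp only [mem_compl_iff, finalSliceSingularSet, mem_setOf_eq, IsBackwardSingularPoint,
    not_forall] at hx
  obtain ⟨r, hr, hfin⟩ := hx
  refine ⟨r / 2, by positivity, fun y hy => ?_⟩
  simp only [mem_compl_iff, finalSliceSingularSet, mem_setOf_eq, IsBackwardSingularPoint,
    not_forall]
  refine ⟨r / 2, by positivity, fun htop => hfin ?_⟩
  have hsub : parabolicCylinder (r / 2) ((0 : ℝ), y) ⊆ parabolicCylinder r ((0 : ℝ), x) := by
    rintro ⟨t, w⟩ hw
    rw [mem_parabolicCylinder] at hw ⊢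
    obtain ⟨⟨ht1, ht2⟩, hd⟩ := hw
    refine ⟨⟨?_, ht2⟩, ?_⟩
    · have : (r / 2) ^ 2 ≤ r ^ 2 := by nlinarith
      simp only at ht1 ⊢
      linarith
    · calc dist w x ≤ dist w y + dist y x := dist_triangle _ _ _
        _ < r / 2 + r / 2 := add_lt_add hd (mem_ball.1 hy)
        _ = r := by ring
  have hle : eLpNorm (uncurry u) ∞ (volume.restrict (parabolicCylinder (r / 2) ((0 : ℝ), y))) ≤
      eLpNorm (uncurry u) ∞ (volume.restrict (parabolicCylinder r ((0 : ℝ), x))) :=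
    eLpNorm_mono_measure _ (Measure.restrict_mono hsub le_rfl)
  rw [htop] at hle
  exact top_le_iff.1 hle

/-- The origin is in `Σ(u)` for every rate/apex profile (definition). -/
theorem zero_mem_finalSliceSingularSet (h : IsRateProfile C u p G) :
    (0 : ℝ³) ∈ finalSliceSingularSet u :=
  h.2.2.2.2

/-- **Under the apex bound `Σ(u) ⊆ {0}`** (library `not_isBackwardSingularPoint_of_hasTypeIDecay`):
together with `not_isBackwardSingularPoint_of_rate_of_neg`, an apex profile has exactly ONE
singular point with `t ≤ 0`, the apex. Under the mere rate `Σ(u)` is only known to be closed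
(and 𝓟¹-null by CKN, not in tree here). -/
theorem finalSliceSingularSet_subset_of_apex {C : ℝ} {u : ℝ → ℝ³ → ℝ³} (h : HasTypeIDecay C u) :
    finalSliceSingularSet u ⊆ {0} := by
  intro x hx
  by_contra hne
  exact not_isBackwardSingularPoint_of_hasTypeIDecay h hne hx

/-- Hence for an apex profile `Σ(u) = {0}`. -/
theorem finalSliceSingularSet_eq_of_apex (h : IsApexProfile C u p G) :
    finalSliceSingularSet u = {0} :=
  (finalSliceSingularSet_subset_of_apex h.2.2.2.1).antisymm
    (singleton_subset_iff.2 (zero_mem_finalSliceSingularSet h.isRateProfile))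

/-! ## §3b Translation covariance: the antecedent may assume the singular point ANYWHERE at `t ≤ 0`

The rate class is covariant under spatial translations (CKN §2 covariance `stRescale` with
`α = γ = 1`, A–B's `𝐈` is translation invariant, the rate is, and backward singular points move
along). With §3 (no singular point at negative times) the antecedent of the crux is equivalent to
"some Type-I-rate suitable weak solution on the slab with `𝐈 < ⊤` has a backward singular point
`z` with `z.1 ≤ 0`" — the normalisation "singular at the origin" costs nothing. -/

namespace Translate

/-- Spatial translate `ψ(t, x₀ + x)`. -/
def translate {F : Type*} (x₀ : ℝ³) (ψ : ℝ → ℝ³ → F) : ℝ → ℝ³ → F := fun t x => ψ t (x₀ + x)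

/-- The unit zoom `1 • stPull 1 1 0 x₀` is the spatial translate (velocity). -/
theorem translate_u_eq (x₀ : ℝ³) (u : ℝ → ℝ³ → ℝ³) :
    (1 : ℝ) • stPull (1 ^ 2) 1 0 x₀ u = translate x₀ u := by
  funext s y
  simp [stPull, translate]

/-- Same for the pressure. -/
theorem translate_p_eq (x₀ : ℝ³) (p : ℝ → ℝ³ → ℝ) :
    (1 : ℝ) ^ 2 • stPull (1 ^ 2) 1 0 x₀ p = translate x₀ p := by
  funext s y
  simp [stPull, translate]

/-- Same for the gradient. -/
theorem translate_G_eq (x₀ : ℝ³) (G : ℝ → ℝ³ → ℝ³ →L[ℝ] ℝ³) :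
    (1 : ℝ) ^ 2 • stPull (1 ^ 2) 1 0 x₀ G = translate x₀ G := by
  funext s y
  simp [stPull, translate]

/-- Same for the gradient, `(1·1) •` form. -/
theorem translate_G_eq' (x₀ : ℝ³) (G : ℝ → ℝ³ → ℝ³ →L[ℝ] ℝ³) :
    ((1 : ℝ) * 1) • stPull (1 ^ 2) 1 0 x₀ G = translate x₀ G := by
  funext s y
  simp [stPull, translate]

/-- The unit space translation fixes the lower half-space. -/
theorem stAffine_one_preimage_lowerHalf (x₀ : ℝ³) :
    stAffine (1 ^ 2) 1 0 x₀ ⁻¹' (Iio (0 : ℝ) ×ˢ (univ : Set ℝ³)) = Iio (0 : ℝ) ×ˢ univ := by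
  ext ⟨s, y⟩
  simp [stAffine_apply]

/-- ... and the slab. -/
theorem stPreimage_one_slab (x₀ : ℝ³) : stPreimage (1 ^ 2) 1 0 x₀ 𝕊 = 𝕊 := by
  ext z
  simp

variable {u : ℝ → ℝ³ → ℝ³} {p : ℝ → ℝ³ → ℝ} {G : ℝ → ℝ³ → ℝ³ →L[ℝ] ℝ³} {C : ℝ}

/-- Suitable weak solutions on the slab are translation covariant (CKN §2; `stRescale` with
`α = γ = 1`). -/
theorem isSuitableWeakSolutionOn_translate (h : IsSuitableWeakSolutionOn 𝕊 1 0 u p) (x₀ : ℝ³) :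
    IsSuitableWeakSolutionOn 𝕊 1 0 (translate x₀ u) (translate x₀ p) := by
  have key := h.stRescale (α := 1) (β := 1 ^ 2) (γ := 1) one_pos one_pos (by norm_num) 0 x₀
  rw [stPreimage_one_slab] at key
  have hν : (1 : ℝ) * 1 / 1 = 1 := by norm_num
  have hf : ((1 : ℝ) ^ 2 * 1) • stPull (1 ^ 2) 1 0 x₀ (0 : ℝ → ℝ³ → ℝ³) = 0 := by
    funext s y
    simp [stPull]
  rw [hν, hf, translate_u_eq, translate_p_eq] at key
  exact key

/-- Weak spatial gradients are translation covariant. -/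
theorem hasWeakSpatialGradientOn_translate (h : HasWeakSpatialGradientOn 𝕊 u G) (x₀ : ℝ³) :
    HasWeakSpatialGradientOn 𝕊 (translate x₀ u) (translate x₀ G) := by
  have key := h.stRescale 1 (β := 1 ^ 2) (γ := 1) (by norm_num) one_pos 0 x₀
  rw [stPreimage_one_slab, translate_u_eq, translate_G_eq'] at key
  exact key

/-- `𝐈(ℝ³ × ℝ₋)` is translation invariant. -/
theorem typeIBound_translate (x₀ : ℝ³) (u : ℝ → ℝ³ → ℝ³) (p : ℝ → ℝ³ → ℝ)
    (G : ℝ → ℝ³ → ℝ³ →L[ℝ] ℝ³) :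
    typeIBound (Iio (0 : ℝ) ×ˢ (univ : Set ℝ³)) (translate x₀ u) (translate x₀ p) (translate x₀ G) =
      typeIBound (Iio (0 : ℝ) ×ˢ (univ : Set ℝ³)) u p G := by
  have key := typeIBound_nsZoom one_pos 0 x₀ (Iio (0 : ℝ) ×ˢ (univ : Set ℝ³)) u p G
  rwa [stAffine_one_preimage_lowerHalf, translate_u_eq, translate_p_eq, translate_G_eq] at key

/-- The rate is translation invariant. -/
theorem hasTypeITimeDecay_translate (h : HasTypeITimeDecay C u) (x₀ : ℝ³) :
    HasTypeITimeDecay C (translate x₀ u) :=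
  fun t ht x => h t ht (x₀ + x)

/-- Backward singular points move with the translation: `(0, x₀)` for `u` is `(0, 0)` for the
translate. -/
theorem isBackwardSingularPoint_translate_iff (x₀ : ℝ³) (u : ℝ → ℝ³ → ℝ³) :
    IsBackwardSingularPoint (translate x₀ u) 0 ↔ IsBackwardSingularPoint u ((0 : ℝ), x₀) := by
  have key : ∀ r : ℝ, eLpNorm (uncurry (translate x₀ u)) ∞ (volume.restrict (parabolicCylinder r 0)) =
      eLpNorm (uncurry u) ∞ (volume.restrict (parabolicCylinder r ((0 : ℝ), x₀))) := by
    intro r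
    have h := eLpNorm_top_nsZoom one_pos 0 x₀ r (0 : ℝ × ℝ³) u
    rw [translate_u_eq, ENNReal.ofReal_one, one_mul, one_mul] at h
    have h0 : stAffine (1 ^ 2) 1 0 x₀ (0 : ℝ × ℝ³) = ((0 : ℝ), x₀) := by
      simp [stAffine]
    rwa [h0] at h
  simp only [IsBackwardSingularPoint, key]

end Translate

open Translate in
/-- A rate profile singular at `(0, x₀)` translates to a rate profile singular at the origin. -/
theorem isRateProfile_translate {x₀ : ℝ³} (hs : IsSuitableWeakSolutionOn 𝕊 1 0 u p)
    (hg : HasWeakSpatialGradientOn 𝕊 u G)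
    (hI : typeIBound (Set.Iio (0 : ℝ) ×ˢ Set.univ) u p G < ⊤) (hd : HasTypeITimeDecay C u)
    (hsing : IsBackwardSingularPoint u ((0 : ℝ), x₀)) :
    IsRateProfile C (translate x₀ u) (translate x₀ p) (translate x₀ G) :=
  ⟨isSuitableWeakSolutionOn_translate hs x₀, hasWeakSpatialGradientOn_translate hg x₀,
    by rwa [typeIBound_translate], hasTypeITimeDecay_translate hd x₀,
    (isBackwardSingularPoint_translate_iff x₀ u).2 hsing⟩

/-- **The antecedent of the crux ⇔ "a Type-I-rate slab solution with `𝐈 < ⊤` is singular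
SOMEWHERE at a time `≤ 0`"** (negative times are excluded by the rate, §3; the final slice is
homogeneous under translations, §3b). -/
theorem rateProfileExists_iff_singular_somewhere :
    RateProfileExists ↔
      ∃ (C : ℝ) (u : ℝ → ℝ³ → ℝ³) (p : ℝ → ℝ³ → ℝ) (G : ℝ → ℝ³ → ℝ³ →L[ℝ] ℝ³) (z : ℝ × ℝ³),
        z.1 ≤ 0 ∧ IsSuitableWeakSolutionOn 𝕊 1 0 u p ∧ HasWeakSpatialGradientOn 𝕊 u G ∧
          typeIBound (Set.Iio (0 : ℝ) ×ˢ Set.univ) u p G < ⊤ ∧ HasTypeITimeDecay C u ∧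
            IsBackwardSingularPoint u z := by
  constructor
  · rintro ⟨C, u, p, G, hs, hg, hI, hd, hsing⟩
    exact ⟨C, u, p, G, 0, le_rfl, hs, hg, hI, hd, hsing⟩
  · rintro ⟨C, u, p, G, ⟨t₀, x₀⟩, ht₀, hs, hg, hI, hd, hsing⟩
    rcases (show t₀ ≤ 0 from ht₀).lt_or_eq with hlt | heq
    · exact absurd hsing (not_isBackwardSingularPoint_of_rate_of_neg hd hlt x₀)
    · subst heq
      exact ⟨C, _, _, _, isRateProfile_translate hs hg hI hd hsing⟩

/-- Hence the crux in its most flexible antecedent form. -/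
theorem apexLocalisation_iff_singular_somewhere :
    RellichScar.ApexLocalisation ↔
      ((∃ (C : ℝ) (u : ℝ → ℝ³ → ℝ³) (p : ℝ → ℝ³ → ℝ) (G : ℝ → ℝ³ → ℝ³ →L[ℝ] ℝ³) (z : ℝ × ℝ³),
        z.1 ≤ 0 ∧ IsSuitableWeakSolutionOn 𝕊 1 0 u p ∧ HasWeakSpatialGradientOn 𝕊 u G ∧
          typeIBound (Set.Iio (0 : ℝ) ×ˢ Set.univ) u p G < ⊤ ∧ HasTypeITimeDecay C u ∧
            IsBackwardSingularPoint u z) → ApexProfileExists) := by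
  rw [apexLocalisation_iff, rateProfileExists_iff_singular_somewhere]

/-- The final-slice singular set translates: `Σ(u(·, x₀ + ·)) = Σ(u) − x₀`. -/
theorem finalSliceSingularSet_translate (x₀ : ℝ³) (u : ℝ → ℝ³ → ℝ³) :
    finalSliceSingularSet (Translate.translate x₀ u) = (fun x => x₀ + x) ⁻¹' finalSliceSingularSet u := by
  ext x
  simp only [finalSliceSingularSet, mem_setOf_eq, mem_preimage]
  have h := Translate.isBackwardSingularPoint_translate_iff (x₀ + x) u
  have e : Translate.translate (x₀ + x) u = Translate.translate x (Translate.translate x₀ u) := by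
    funext t y
    simp [Translate.translate, add_assoc]
  rw [e, Translate.isBackwardSingularPoint_translate_iff] at h
  -- h : IsBackwardSingularPoint (translate x₀ u) (0, x) ↔ IsBackwardSingularPoint u (0, x₀ + x)
  exact h

/-! ## §4 Dictionary: apex = rate + global spatial bound -/

/-- The apex bound gives the KNSS spatial bound `‖x‖ ‖u(t,x)‖ ≤ C`. -/
theorem spatial_of_hasTypeIDecay {C : ℝ} {u : ℝ → ℝ³ → ℝ³} (h : HasTypeIDecay C u)
    (t : ℝ) (ht : t < 0) (x : ℝ³) : ‖x‖ * ‖u t x‖ ≤ C := by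
  have key := h t ht x
  have hs : 0 < Real.sqrt (-t) := Real.sqrt_pos.2 (by linarith)
  have hden : 0 < ‖x‖ + Real.sqrt (-t) := by positivity
  rw [le_div_iff₀ hden] at key
  nlinarith [norm_nonneg (u t x), Real.sqrt_nonneg (-t), norm_nonneg x,
    mul_nonneg (norm_nonneg (u t x)) (Real.sqrt_nonneg (-t))]

/-- Conversely rate `C` + spatial bound `K` give the apex bound with constant `C + K`
(add the two inequalities `‖u‖√(−t) ≤ C`, `‖u‖‖x‖ ≤ K`). -/
theorem hasTypeIDecay_of_rate_of_spatial {C K : ℝ} {u : ℝ → ℝ³ → ℝ³} (hr : HasTypeITimeDecay C u)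
    (hK : ∀ t < 0, ∀ x, ‖x‖ * ‖u t x‖ ≤ K) : HasTypeIDecay (C + K) u := by
  intro t ht x
  have hs : 0 < Real.sqrt (-t) := Real.sqrt_pos.2 (by linarith)
  have h1 := hr t ht x
  have h2 := hK t ht x
  rw [le_div_iff₀ hs] at h1
  rw [le_div_iff₀ (by positivity)]
  nlinarith

/-- **Spatial-bound form of the crux**: `ApexLocalisation ↔ (RateProfileExists → some rate
profile obeys a GLOBAL spatial bound ‖x‖‖u‖ ≤ K)` — "localise the `K/‖x‖` law" (KNSS 2009 (1.6)
vs (1.4)). The parasitic flow violates the spatial law maximally; the kinematic content of the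
crux is the passage from `0 ∈ Σ(u)` to `sup ‖x‖‖u‖ < ∞` for SOME profile. -/
theorem apexLocalisation_iff_spatialBound :
    RellichScar.ApexLocalisation ↔
      (RateProfileExists → ∃ (C : ℝ) (u : ℝ → ℝ³ → ℝ³) (p : ℝ → ℝ³ → ℝ) (G : ℝ → ℝ³ → ℝ³ →L[ℝ] ℝ³)
        (K : ℝ), IsRateProfile C u p G ∧ ∀ t < 0, ∀ x, ‖x‖ * ‖u t x‖ ≤ K) := by
  rw [apexLocalisation_iff]
  constructor
  · intro h hr
    obtain ⟨C, u, p, G, ha⟩ := h hr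
    exact ⟨C, u, p, G, C, ha.isRateProfile, spatial_of_hasTypeIDecay ha.2.2.2.1⟩
  · intro h hr
    obtain ⟨C, u, p, G, K, hrp, hK⟩ := h hr
    exact ⟨C + K, u, p, G, hrp.1, hrp.2.1, hrp.2.2.1,
      hasTypeIDecay_of_rate_of_spatial hrp.2.2.2.1 hK, hrp.2.2.2.2⟩

/-! ## §5 Refuted strengthenings (explicit witnesses) -/

/-- **"Some translate / zoom of the SAME profile is apex" is false without `𝐈 < ⊤`.** The
parasitic flow is a suitable weak solution with the rate and a singular origin whose whole
translation–scaling orbit is itself (`parasitic_translate`, `parasitic_nsRescale`) and which is in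
no apex class. (With `𝐈 < ⊤` added the statement quantifies over the rate class and is open.)
Compare the library's `not_rate_imp_spaceTime_of_suitable_singular` (no orbit). -/
theorem not_orbit_upgrade_without_I :
    ¬ ∀ (C : ℝ) (u : ℝ → ℝ³ → ℝ³) (p : ℝ → ℝ³ → ℝ) (G : ℝ → ℝ³ → ℝ³ →L[ℝ] ℝ³),
        IsSuitableWeakSolutionOn 𝕊 1 0 u p → HasWeakSpatialGradientOn 𝕊 u G →
          HasTypeITimeDecay C u → IsBackwardSingularPoint u 0 →
            ∃ (lam : ℝ) (x₀ : ℝ³) (C' : ℝ), 0 < lam ∧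
              HasTypeIDecay C' (nsRescale lam (fun t x => u t (x + x₀))) := by
  intro h
  obtain ⟨lam, x₀, C', hlam, hC'⟩ := h 1 _ _ _ (parasitic_isSuitableWeakSolutionOn 1)
    (parasitic_hasWeakSpatialGradientOn 1) (parasitic_hasTypeITimeDecay zero_le_one)
    (parasitic_isBackwardSingularPoint_zero one_pos)
  rw [parasitic_translate 1 x₀, parasitic_nsRescale 1 hlam] at hC'
  exact parasitic_not_hasTypeIDecay one_pos C' hC'

/-- **"Rate ⇒ space–time bound" is false pointwise** (no PDE): the rate class is strictly larger
than the apex class already kinematically; singular final-slice points off the origin are the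
obstruction (`not_isBackwardSingularPoint_of_hasTypeIDecay` vs `parasitic_isBackwardSingularPoint`). -/
theorem not_rate_imp_apex_pointwise :
    ¬ ∀ (C : ℝ) (u : ℝ → ℝ³ → ℝ³), HasTypeITimeDecay C u → ∃ C', HasTypeIDecay C' u := by
  intro h
  obtain ⟨C', hC'⟩ := h 1 (parasiticVelocity 1) (parasitic_hasTypeITimeDecay zero_le_one)
  exact parasitic_not_hasTypeIDecay one_pos C' hC'

/-- **The translated parasitic flow is singular at EVERY final-slice point**: its `Σ` is all of
`ℝ³` — the extreme opposite of the apex picture `Σ = {0}`; only `𝐈 < ⊤` separates the two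
(kinematically `𝐈 < ⊤` forces averaged decay `r⁻¹ ∫_{B_r} |u(t)|² ≤ 𝐈`, incompatible with a
spatially constant slice, library `ae_slice_eq_zero_of_abTypeIBound`). -/
theorem finalSliceSingularSet_parasitic {C : ℝ} (hC : 0 < C) :
    finalSliceSingularSet (parasiticVelocity C) = univ :=
  eq_univ_of_forall fun x => parasitic_isBackwardSingularPoint hC x


end Summit.NavierStokesRegularity.NavierStokesRegularity.Theorems.ApexLocalisation.Negative
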